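import Summits.CriticalPhenomena.SAWScalingLimit.Theorems.AvoidanceLimit.Negative.AvoidanceLimitWitnessDomains
import Literature.Probability.RandomPlanarGeometry.StarHullExtension
import Literature.Probability.RandomPlanarGeometry.RestrictionHullsProofs
import Literature.Probability.RandomPlanarGeometry.RestrictionHullsRiemannProofs

/-!
# Negative knowledge on crux `AvoidanceLimit`, part 6: the exponent is rigid

Support file (refuter / cdisprove lane, cycle 2) for the crux
`Summit.CriticalPhenomena.SAWScalingLimit.Theses.SAWLoopFugacityFlow.AvoidanceLimit`
(stmt-CriticalPhenomena-10649). `AvoidanceLimitExp p` is the crux with the restriction exponent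
`5/8` replaced by a real parameter `p` (so `AvoidanceLimitExp (5/8)` IS the crux, `Iff.rfl`).

* `restrictionDeriv_lt_one` — **`Φ'_A(0) < 1` for every `*`-hull meeting the open half-plane**
  (the strict form of [LSW] (2.4) `0 < Φ'_A(0) ≤ 1`): with `E` the Schwarz reflection of `Φ_A`
  (`hullExt`), `G(z) = z − E(z)` is holomorphic at `0`, vanishes there, has `Im G ≥ 0` on the upper
  half-disc (`Im Φ ≤ Im z`) and `G'(0) = 1 − Φ'_A(0)`; if `G'(0) = 0` then either `G ≡ 0` near `0`
  (then `Φ_A = id` on the connected open set `ℍ ∖ A` by the identity theorem, so `Φ_A` could not be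
  onto `ℍ`) or `G = zⁿ g`, `n ≥ 2`, `g(0) ≠ 0`, and `Im G < 0` along some direction — impossible.
* `avoidanceLimitExp_unique` — **at most one exponent can hold**: `AvoidanceLimitExp p →
  AvoidanceLimitExp q → p = q`, because the strip `flatRect ⊊ bigSq` is a hull subdomain whose
  pulled-back hull meets `ℍ`, so its restriction derivative is some `d ∈ (0, 1)` and the same
  lattice sequence would converge to `d^p` and to `d^q`.
* `avoidanceLimit_not_exp` — hence the crux EXCLUDES every other exponent (e.g. the `n = 1`/Ising
  value `1/2` and the Brownian-excursion value `1`): any proof must use input that singles out `5/8`;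
  no value-free (pure restriction-covariance) argument can close it.
* `not_avoidanceLimitExp_of_neg` — negative exponents are refuted UNCONDITIONALLY (avoidance
  probabilities are `≤ 1 < d^p`).

[cite: LawlerSchrammWerner2003Restriction, §2 (2.4) p. 7]
-/

noncomputable section

open Set Filter Topology MeasureTheory Complex Metric
open UpperHalfPlane (upperHalfPlaneSet isOpen_upperHalfPlaneSet)
open Literature.Probability.RandomPlanarGeometry Literature.Probability.LatticeModels
open Summit.CriticalPhenomena.SAWScalingLimit.Theses.SAWLoopFugacityFlow (AvoidanceLimit)

namespace Summit.CriticalPhenomena.SAWScalingLimit.Theorems.AvoidanceLimit.Negative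

/-! ### The one-parameter family of statements -/

/-- The crux `AvoidanceLimit` with the exponent `5/8` replaced by `p` (everything else verbatim). -/
def AvoidanceLimitExp (p : ℝ) : Prop :=
  ∀ (D D' : DobrushinDomain) (a b : ℝ → Site 2), SAW.IsEndpointApprox D a b →
    D'.carrier ⊆ D.carrier → D'.pt 0 = D.pt 0 → D'.pt 1 = D.pt 1 →
    (∃ ε : ℝ, 0 < ε ∧ D'.carrier ∩ Metric.ball (D.pt 0) ε = D.carrier ∩ Metric.ball (D.pt 0) ε ∧
      D'.carrier ∩ Metric.ball (D.pt 1) ε = D.carrier ∩ Metric.ball (D.pt 1) ε) →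
    ∀ (φ : ConformalEquiv upperHalfPlaneSet D.carrier), D.IsChordalUniformizing φ →
    ∀ (A : Set ℂ), A = closure (upperHalfPlaneSet \ {z | z ∈ upperHalfPlaneSet ∧ φ z ∈ D'.carrier}) →
    ∀ (Φ : ConformalEquiv (upperHalfPlaneSet \ A) upperHalfPlaneSet) (d : ℝ),
      IsRestrictionMap A Φ → HasRestrictionDeriv A Φ d →
      Tendsto (fun δ => ((SAW.law D.carrier δ (a δ) (b δ)).map (fun γ => γ.curve))
        (CurveClass.rangeSubset (closure D'.carrier))) (𝓝[>] 0)
        (𝓝 (ENNReal.ofReal (d ^ p)))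

/-- The member `p = 5/8` of the family is the crux, definitionally. -/
theorem avoidanceLimitExp_iff : AvoidanceLimitExp ((5 : ℝ) / 8) ↔ AvoidanceLimit := Iff.rfl

/-! ### `Φ'_A(0) < 1` for hulls meeting the open half-plane -/

/-- Local analysis at a real boundary point, non-strict version of the tree's
`SchwarzReflection.deriv_ne_zero_of_im_pos`: if `F` is holomorphic on `B(0, r)`, `F(0) = 0`, `F` is
not identically zero near `0` and `Im F ≥ 0` on the upper half-disc, then `F'(0) ≠ 0` (otherwise
`F = zⁿ g` with `n ≥ 2`, `g(0) ≠ 0`, and `Im F(tω) < 0` for small `t > 0` along a direction `ω ∈ ℍ`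
with `Im (ωⁿ g(0)) < 0`). [folklore] -/
theorem deriv_ne_zero_of_im_nonneg {F : ℂ → ℂ} {r : ℝ} (hr : 0 < r)
    (hF : DifferentiableOn ℂ F (ball (0 : ℂ) r)) (hF0 : F 0 = 0)
    (hnn : ∀ z ∈ upperHalfPlaneSet ∩ ball (0 : ℂ) r, 0 ≤ (F z).im)
    (hne : ¬∀ᶠ z in 𝓝 (0 : ℂ), F z = 0) : deriv F 0 ≠ 0 := by
  intro hc
  have han : AnalyticAt ℂ F 0 := hF.analyticAt (ball_mem_nhds 0 hr)
  -- paths `t ↦ t ω` into the half-disc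
  have hpath : ∀ ω : ℂ, 0 < ω.im → Tendsto (fun t : ℝ ↦ (t : ℂ) * ω) (𝓝[>] 0) (𝓝 0) ∧
      ∀ᶠ t : ℝ in 𝓝[>] 0, (t : ℂ) * ω ∈ upperHalfPlaneSet ∩ ball (0 : ℂ) r := by
    intro ω hω
    have h1 : Tendsto (fun t : ℝ ↦ (t : ℂ) * ω) (𝓝[>] 0) (𝓝 0) := by
      have : Continuous fun t : ℝ ↦ (t : ℂ) * ω := by fun_prop
      simpa using (this.tendsto 0).mono_left nhdsWithin_le_nhds
    refine ⟨h1, ?_⟩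
    filter_upwards [h1.eventually (ball_mem_nhds (0 : ℂ) hr), self_mem_nhdsWithin] with t ht ht0
    refine ⟨?_, ht⟩
    show 0 < ((t : ℂ) * ω).im
    have ht0' : 0 < t := ht0
    simpa using mul_pos ht0' hω
  obtain ⟨n, g, hg, hg0, hFg⟩ := han.exists_eventuallyEq_pow_smul_nonzero_iff.2 hne
  simp only [sub_zero, smul_eq_mul] at hFg
  have hn0 : n ≠ 0 := by
    rintro rfl
    have h := hFg.self_of_nhds
    rw [hF0, pow_zero, one_mul] at h
    exact hg0 h.symm
  have hn1 : n ≠ 1 := by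
    rintro rfl
    have hg' : HasDerivAt (fun z ↦ z ^ 1 * g z) (g 0) 0 := by
      have h := (hasDerivAt_id' (0 : ℂ)).fun_mul hg.differentiableAt.hasDerivAt
      simp only [one_mul, zero_mul, add_zero] at h
      simpa only [pow_one] using h
    have hF' : HasDerivAt F (g 0) 0 := hg'.congr_of_eventuallyEq hFg
    exact hg0 (by rw [← hF'.deriv, hc])
  have hn2 : 2 ≤ n := by omega
  obtain ⟨ω, hωim, hωneg⟩ := SchwarzReflection.exists_im_pow_mul_neg hn2 hg0
  obtain ⟨h1, h2⟩ := hpath ω hωim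
  have hgt : Tendsto (fun t : ℝ ↦ ω ^ n * g (t * ω)) (𝓝[>] 0) (𝓝 (ω ^ n * g 0)) :=
    ((hg.continuousAt.tendsto).comp h1).const_mul _
  have hev_neg : ∀ᶠ t : ℝ in 𝓝[>] 0, (ω ^ n * g (t * ω)).im < 0 :=
    ((continuous_im.tendsto _).comp hgt).eventually (Iio_mem_nhds hωneg)
  have hev_eq : ∀ᶠ t : ℝ in 𝓝[>] 0, F (t * ω) = (t * ω) ^ n * g (t * ω) := h1.eventually hFg
  obtain ⟨t, ht1, ht2, ht3, ht0⟩ := (hev_neg.and (hev_eq.and (h2.and self_mem_nhdsWithin))).exists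
  have ht0' : 0 < t := ht0
  have hFnn := hnn _ ht3
  rw [ht2, mul_pow, mul_assoc, ← ofReal_pow, im_ofReal_mul] at hFnn
  have : (t : ℝ) ^ n * (ω ^ n * g (t * ω)).im < 0 := mul_neg_of_pos_of_neg (pow_pos ht0' n) ht1
  linarith

/-- **`Φ'_A(0) < 1` as soon as the `*`-hull `A` meets the open half-plane** (strict form of
[LSW] (2.4): `0 < Φ'_A(0) ≤ 1`, with equality only for the trivial hull). Proof: `G(z) = z − E(z)`,
`E` the Schwarz reflection `hullExt Φ` of `Φ_A` across `ℝ ∖ A`, is holomorphic near `0` with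
`G(0) = 0`, `G'(0) = 1 − Φ'_A(0)` and `Im G ≥ 0` on the upper half-disc (`Im Φ_A ≤ Im z`). If
`Φ'_A(0) = 1` then `G'(0) = 0`, so by `deriv_ne_zero_of_im_nonneg` `G ≡ 0` near `0`; then
`Φ_A = id` near a point of `ℍ ∖ A`, hence on all of the connected open set `ℍ ∖ A` (identity
theorem), and `Φ_A(ℍ ∖ A) = ℍ` would force `A ∩ ℍ = ∅`.
[cite: LawlerSchrammWerner2003Restriction, §2 (2.4) p. 7] -/
theorem restrictionDeriv_lt_one {A : Set ℂ} (hA : IsStarHull A)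
    {Φ : ConformalEquiv (upperHalfPlaneSet \ A) upperHalfPlaneSet} (hΦ : IsRestrictionMap A Φ)
    {d : ℝ} (hd : HasRestrictionDeriv A Φ d) (hne : (A ∩ upperHalfPlaneSet).Nonempty) : d < 1 := by
  obtain ⟨d', -, hd1', hd'⟩ := IsStarHull.exists_hasRestrictionDeriv_holds hA hΦ
  have hdd : d = d' := hd.unique hA hd'
  have hd1 : d ≤ 1 := hdd ▸ hd1'
  refine lt_of_le_of_ne hd1 fun hdeq ↦ ?_
  -- the reflected map and `G = id - E`
  have hEd : DifferentiableOn ℂ (hullExt Φ) (symmDomain A) :=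
    differentiableOn_hullExt hA.isBoundedHull hΦ
  obtain ⟨r, hr, hball⟩ : ∃ r > 0, ball (0 : ℂ) r ⊆ symmDomain A :=
    Metric.isOpen_iff.1 (isOpen_symmDomain hA.isBoundedHull.isClosed) 0 hA.zero_mem_symmDomain
  set G : ℂ → ℂ := fun z ↦ z - hullExt Φ z with hG
  have hGd : DifferentiableOn ℂ G (ball (0 : ℂ) r) := differentiableOn_id.sub (hEd.mono hball)
  have hG0 : G 0 = 0 := by
    simp only [hG, hullExt_zero hA hΦ, sub_zero]
  have hGderiv : deriv G 0 = 1 - (d : ℂ) :=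
    ((hasDerivAt_id (0 : ℂ)).sub (hasDerivAt_hullExt_zero hA hΦ hd)).deriv
  have hGnn : ∀ z ∈ upperHalfPlaneSet ∩ ball (0 : ℂ) r, 0 ≤ (G z).im := by
    rintro z ⟨hzU, hzr⟩
    have hzA : z ∈ upperHalfPlaneSet \ A := ⟨hzU, (hball hzr).1⟩
    have h := hullExt_im_le hA.isBoundedHull hΦ hzA
    simp only [hG, sub_im, sub_nonneg]
    exact h
  -- `G` is not identically zero near `0`: otherwise `Φ = id` on `ℍ ∖ A`
  have hGne : ¬∀ᶠ z in 𝓝 (0 : ℂ), G z = 0 := by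
    intro hev
    obtain ⟨r', hr', hsub'⟩ := Metric.eventually_nhds_iff_ball.1 hev
    set ρ : ℝ := min r r' with hρ
    have hρ0 : 0 < ρ := lt_min hr hr'
    set z₀ : ℂ := ((ρ / 2 : ℝ) : ℂ) * I with hz₀
    have hz₀im : z₀.im = ρ / 2 := by simp [hz₀]
    have hz₀norm : ‖z₀‖ = ρ / 2 := by
      rw [hz₀, norm_mul, Complex.norm_I, mul_one, Complex.norm_real, Real.norm_eq_abs,
        abs_of_pos (by positivity)]
    have hz₀U : z₀ ∈ upperHalfPlaneSet := by
      show 0 < z₀.im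
      rw [hz₀im]; positivity
    have hz₀r : z₀ ∈ ball (0 : ℂ) r := by
      rw [Metric.mem_ball, dist_zero_right, hz₀norm]
      linarith [min_le_left r r']
    have hz₀A : z₀ ∈ upperHalfPlaneSet \ A := ⟨hz₀U, (hball hz₀r).1⟩
    -- `Φ = id` near `z₀`
    have hevid : (fun z ↦ Φ z) =ᶠ[𝓝 z₀] id := by
      have hmem : ball z₀ (ρ / 2) ∩ upperHalfPlaneSet ∈ 𝓝 z₀ :=
        inter_mem (ball_mem_nhds _ (by positivity)) (isOpen_upperHalfPlaneSet.mem_nhds hz₀U)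
      filter_upwards [hmem] with z hz
      obtain ⟨hzb, hzU⟩ := hz
      have hzr' : z ∈ ball (0 : ℂ) r' := by
        rw [Metric.mem_ball, dist_zero_right]
        rw [Metric.mem_ball] at hzb
        calc ‖z‖ = ‖(z - z₀) + z₀‖ := by ring_nf
          _ ≤ ‖z - z₀‖ + ‖z₀‖ := norm_add_le _ _
          _ < ρ / 2 + ρ / 2 := by rw [hz₀norm, ← dist_eq_norm]; linarith
          _ = ρ := by ring
          _ ≤ r' := min_le_right r r'
      have h := hsub' z hzr'
      simp only [hG, sub_eq_zero] at h
      rw [hullExt_of_im_pos hzU] at h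
      exact h.symm
    -- identity theorem on the connected open set `ℍ ∖ A`
    have hopen : IsOpen (upperHalfPlaneSet \ A) :=
      isOpen_upperHalfPlaneSet.sdiff hA.isBoundedHull.isClosed
    have hpre : IsPreconnected (upperHalfPlaneSet \ A) :=
      hA.1.2.2.isPathConnected.isConnected.isPreconnected
    have hanΦ : AnalyticOnNhd ℂ (fun z ↦ Φ z) (upperHalfPlaneSet \ A) :=
      Φ.differentiableOn_coe.analyticOnNhd hopen
    have heq : EqOn (fun z ↦ Φ z) id (upperHalfPlaneSet \ A) :=
      hanΦ.eqOn_of_preconnected_of_eventuallyEq analyticOnNhd_id hpre hz₀A hevid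
    obtain ⟨w, hwA, hwU⟩ := hne
    have hw' : Φ.symm w ∈ upperHalfPlaneSet \ A := Φ.symm_mapsTo hwU
    have h1 : Φ (Φ.symm w) = w := Φ.apply_symm_apply hwU
    have h2 : Φ (Φ.symm w) = Φ.symm w := heq hw'
    rw [h1] at h2
    exact hw'.2 (h2 ▸ hwA)
  have key := deriv_ne_zero_of_im_nonneg hr hGd hG0 hGnn hGne
  rw [hGderiv, hdeq, Complex.ofReal_one, sub_self] at key
  exact key rfl

/-! ### The strip in the square is a genuine hull subdomain -/

/-- `flatRect` is a hull subdomain of `bigSq` in the tree's sense (`MarkedDomain.IsHullSubdomain`):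
the removed part `bigSq ∖ flatRect` lies in `{|Im z| ≥ 1}`, away from the marked points `±2`.
[folklore] -/
theorem isHullSubdomain_flatRect : bigSq.IsHullSubdomain flatRect := by
  have hcl : closure (bigSq.carrier \ flatRect.carrier) ⊆ {z : ℂ | 1 ≤ |z.im|} := by
    refine closure_minimal ?_ (isClosed_le continuous_const (continuous_abs.comp continuous_im))
    rintro z ⟨hzD, hzD'⟩
    rw [bigSq_carrier, mem_symRect] at hzD
    rw [flatRect_carrier, mem_symRect] at hzD'
    show 1 ≤ |z.im|
    by_contra hlt
    push Not at hlt
    rw [abs_lt] at hlt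
    exact hzD' ⟨hzD.1, hlt.1, hlt.2⟩
  have hnot : ∀ c : ℂ, c.im = 0 → c ∉ closure (bigSq.carrier \ flatRect.carrier) := by
    intro c hc hmem
    have h := hcl hmem
    simp only [mem_setOf_eq, hc, abs_zero] at h
    linarith
  refine ⟨flatRect_subset, ?_, ?_, ?_, ?_⟩
  · rw [flatRect_pt_zero, bigSq_pt_zero]
  · rw [flatRect_pt_one, bigSq_pt_one]
  · rw [bigSq_pt_zero]; exact hnot 2 (by simp)
  · rw [bigSq_pt_one]; exact hnot (-2) (by simp)

/-- The pulled-back hull of the strip meets the open half-plane: the point `φ⁻¹(3i/2)` of `ℍ` is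
mapped into `bigSq ∖ flatRect`. [folklore] -/
theorem pullbackHull_flatRect_inter_nonempty (φ : ConformalEquiv upperHalfPlaneSet bigSq.carrier) :
    (φ.pullbackHull flatRect ∩ upperHalfPlaneSet).Nonempty := by
  set w : ℂ := ((3 / 2 : ℝ) : ℂ) * I with hw
  have hwim : w.im = 3 / 2 := by simp [hw]
  have hwre : w.re = 0 := by simp [hw]
  have hwD : w ∈ bigSq.carrier := by
    rw [bigSq_carrier, mem_symRect, hwre, hwim]
    norm_num
  have hwD' : w ∉ flatRect.carrier := by
    rw [flatRect_carrier, mem_symRect, hwim]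
    norm_num
  have hz : φ.symm w ∈ upperHalfPlaneSet := φ.symm_mapsTo hwD
  refine ⟨φ.symm w, subset_closure ⟨hz, ?_⟩, hz⟩
  rintro ⟨-, h⟩
  rw [φ.apply_symm_apply hwD] at h
  exact hwD' h

/-! ### At most one exponent -/

/-- **The exponent is rigid**: if the avoidance probabilities converge to `Φ'_A(0)^p` for all hull
subdomains and also to `Φ'_A(0)^q`, then `p = q`. Witness: `D = bigSq`, `D' = flatRect`, any
endpoint approximation and chordal uniformizer; the pulled-back hull is a `*`-hull meeting `ℍ`, so
`d = Φ'_A(0) ∈ (0, 1)` (`restrictionDeriv_lt_one`) and `d^p = d^q` forces `p = q`. [folklore] -/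
theorem avoidanceLimitExp_unique {p q : ℝ} (hp : AvoidanceLimitExp p) (hq : AvoidanceLimitExp q) :
    p = q := by
  obtain ⟨a, b, hab⟩ := SAW.exists_isEndpointApprox bigSq
  obtain ⟨φ, hφ⟩ := MarkedDomain.exists_isChordalUniformizing_holds bigSq
  have hball : ∃ ε : ℝ, 0 < ε ∧
      flatRect.carrier ∩ Metric.ball (bigSq.pt 0) ε = bigSq.carrier ∩ Metric.ball (bigSq.pt 0) ε ∧
      flatRect.carrier ∩ Metric.ball (bigSq.pt 1) ε = bigSq.carrier ∩ Metric.ball (bigSq.pt 1) ε := by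
    refine ⟨1, one_pos, ?_, ?_⟩
    · rw [bigSq_pt_zero]; exact flatRect_ball_agree 2 (by simp)
    · rw [bigSq_pt_one]; exact flatRect_ball_agree (-2) (by simp)
  have hpt0 : flatRect.pt 0 = bigSq.pt 0 := by rw [flatRect_pt_zero, bigSq_pt_zero]
  have hpt1 : flatRect.pt 1 = bigSq.pt 1 := by rw [flatRect_pt_one, bigSq_pt_one]
  set A : Set ℂ := φ.pullbackHull flatRect with hAdef
  have hstar : IsStarHull A :=
    IsStarHull.pullbackHull JordanDomain.isSimplyConnected_holds hφ isHullSubdomain_flatRect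
  obtain ⟨Φ, hΦ, -⟩ := IsStarHull.existsUnique_isRestrictionMap_holds hstar
  obtain ⟨d, hd0, -, hd⟩ := IsStarHull.exists_hasRestrictionDeriv_holds hstar hΦ
  have hd1 : d < 1 := restrictionDeriv_lt_one hstar hΦ hd (pullbackHull_flatRect_inter_nonempty φ)
  have kp := hp bigSq flatRect a b hab flatRect_subset hpt0 hpt1 hball φ hφ A rfl Φ d hΦ hd
  have kq := hq bigSq flatRect a b hab flatRect_subset hpt0 hpt1 hball φ hφ A rfl Φ d hΦ hd
  have heq : ENNReal.ofReal (d ^ p) = ENNReal.ofReal (d ^ q) := tendsto_nhds_unique kp kq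
  rw [ENNReal.ofReal_eq_ofReal_iff (Real.rpow_nonneg hd0.le p) (Real.rpow_nonneg hd0.le q)] at heq
  have hlog := congrArg Real.log heq
  rw [Real.log_rpow hd0, Real.log_rpow hd0] at hlog
  have hlogd : Real.log d ≠ 0 := (Real.log_neg hd0 hd1).ne
  exact mul_right_cancel₀ hlogd hlog

/-- No two distinct exponents can hold simultaneously. [folklore] -/
theorem not_avoidanceLimitExp_and {p q : ℝ} (hpq : p ≠ q) :
    ¬ (AvoidanceLimitExp p ∧ AvoidanceLimitExp q) :=
  fun h ↦ hpq (avoidanceLimitExp_unique h.1 h.2)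

/-- **The crux excludes every other exponent**: under `AvoidanceLimit`, the variant with exponent
`q ≠ 5/8` is false — in particular the Ising/`n = 1` value `q = 1/2` and the Brownian-excursion
value `q = 1`. So the crux is not a consequence of any exponent-blind argument. [folklore] -/
theorem avoidanceLimit_not_exp (h : AvoidanceLimit) {q : ℝ} (hq : q ≠ (5 : ℝ) / 8) :
    ¬ AvoidanceLimitExp q :=
  fun hq' ↦ hq (avoidanceLimitExp_unique hq' (avoidanceLimitExp_iff.2 h))

/-- The Ising boundary exponent `1/2` transplanted to the SAW avoidance law contradicts the crux. -/
theorem avoidanceLimit_not_exp_half (h : AvoidanceLimit) : ¬ AvoidanceLimitExp ((1 : ℝ) / 2) :=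
  avoidanceLimit_not_exp h (by norm_num)

/-- The excursion exponent `1` transplanted to the SAW avoidance law contradicts the crux. -/
theorem avoidanceLimit_not_exp_one (h : AvoidanceLimit) : ¬ AvoidanceLimitExp 1 :=
  avoidanceLimit_not_exp h (by norm_num)

/-! ### Negative exponents are refuted unconditionally -/

/-- The pushed-forward SAW law gives mass at most `1` to every event (it is the zero measure or a
probability measure). [folklore] -/
theorem map_law_apply_le_one (Ω : Set ℂ) (δ : ℝ) (a b : Site 2) (s : Set (CurveClass ℂ)) :
    (SAW.law Ω δ a b).map (fun γ ↦ γ.curve) s ≤ 1 := by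
  have htot : SAW.law Ω δ a b univ ≤ 1 := by
    rw [SAW.law, Measure.smul_apply, smul_eq_mul]
    rcases eq_or_ne (SAW.weight Ω δ a b univ) 0 with h0 | h0
    · rw [h0]; simp
    rcases eq_or_ne (SAW.weight Ω δ a b univ) ⊤ with ht | ht
    · rw [ht]; simp
    · rw [ENNReal.inv_mul_cancel h0 ht]
  calc (SAW.law Ω δ a b).map (fun γ ↦ γ.curve) s
      ≤ (SAW.law Ω δ a b).map (fun γ ↦ γ.curve) univ := measure_mono (subset_univ _)
    _ = SAW.law Ω δ a b univ := by
        rw [Measure.map_apply (SAW.DomainSAW.measurable_of_top _) MeasurableSet.univ, preimage_univ]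
    _ ≤ 1 := htot

/-- **Negative exponents are refuted**: for `p < 0` the statement `AvoidanceLimitExp p` would make
avoidance probabilities (`≤ 1`) converge to `d^p > 1` for the strip in the square. [folklore] -/
theorem not_avoidanceLimitExp_of_neg {p : ℝ} (hp : p < 0) : ¬ AvoidanceLimitExp p := by
  intro h
  obtain ⟨a, b, hab⟩ := SAW.exists_isEndpointApprox bigSq
  obtain ⟨φ, hφ⟩ := MarkedDomain.exists_isChordalUniformizing_holds bigSq
  have hball : ∃ ε : ℝ, 0 < ε ∧
      flatRect.carrier ∩ Metric.ball (bigSq.pt 0) ε = bigSq.carrier ∩ Metric.ball (bigSq.pt 0) ε ∧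
      flatRect.carrier ∩ Metric.ball (bigSq.pt 1) ε = bigSq.carrier ∩ Metric.ball (bigSq.pt 1) ε := by
    refine ⟨1, one_pos, ?_, ?_⟩
    · rw [bigSq_pt_zero]; exact flatRect_ball_agree 2 (by simp)
    · rw [bigSq_pt_one]; exact flatRect_ball_agree (-2) (by simp)
  have hpt0 : flatRect.pt 0 = bigSq.pt 0 := by rw [flatRect_pt_zero, bigSq_pt_zero]
  have hpt1 : flatRect.pt 1 = bigSq.pt 1 := by rw [flatRect_pt_one, bigSq_pt_one]
  set A : Set ℂ := φ.pullbackHull flatRect with hAdef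
  have hstar : IsStarHull A :=
    IsStarHull.pullbackHull JordanDomain.isSimplyConnected_holds hφ isHullSubdomain_flatRect
  obtain ⟨Φ, hΦ, -⟩ := IsStarHull.existsUnique_isRestrictionMap_holds hstar
  obtain ⟨d, hd0, -, hd⟩ := IsStarHull.exists_hasRestrictionDeriv_holds hstar hΦ
  have hd1 : d < 1 := restrictionDeriv_lt_one hstar hΦ hd (pullbackHull_flatRect_inter_nonempty φ)
  have key := h bigSq flatRect a b hab flatRect_subset hpt0 hpt1 hball φ hφ A rfl Φ d hΦ hd
  -- the limit of quantities `≤ 1` is `≤ 1`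
  have hle : ENNReal.ofReal (d ^ p) ≤ 1 :=
    le_of_tendsto' key fun δ ↦ map_law_apply_le_one _ _ _ _ _
  have hgt : 1 < d ^ p := Real.one_lt_rpow_of_pos_of_lt_one_of_neg hd0 hd1 hp
  rw [← ENNReal.ofReal_one, ENNReal.ofReal_le_ofReal_iff zero_le_one] at hle
  linarith

end Summit.CriticalPhenomena.SAWScalingLimit.Theorems.AvoidanceLimit.Negative

end
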